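import Mathlib
import HarnessLib

/-!
# `RationalShortRootRigidity` — Step 4 helper (m4): the Lagrange alternation lemma

Helper lemma INSIDE the paper proof of crux `stmt-QuantumFields-23124` (`F4SubCurvatureDoor.RationalShortRootRigidity`,
LINE g15-A of planner ym-idea-3; prover notes HOME l15/PLANAR-LEMMA-DETAILED.md, Step (4d); free-hands menu II, item (m4),
statement typed in HOME l15/Helpers23124.lean as `Helpers.LagrangeAlternation` — proved here DEF-FREE with that body verbatim):

**Lemma** (`lagrangeAlternation`).  Let `P ∈ ℝ[X]` with `P.coeff n = 0` for all `n ≥ k − 1` (i.e. `deg P ≤ k − 2`), and let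
`μ₀ < μ₁ < ⋯ < μ_{k−1}` be `k` strictly increasing real nodes at which the values of `P` weakly alternate in sign:
`(−1)ʲ P(μⱼ) ≥ 0` for all `j`, or `≤ 0` for all `j`.  Then `P = 0`.

Proof.  `deg P < k`, so Lagrange interpolation over the `k` nodes is exact and Mathlib's `Lagrange.coeff_eq_sum` gives
`P.coeff (k−1) = Σⱼ P(μⱼ) / ∏_{i ≠ j} (μⱼ − μᵢ)`; the left side is `0`.  The node product has sign `(−1)^{#{i : i > j}} =
(−1)^{k−1−j}` (`prod_erase_eq_sign_mul`), so after multiplying by `(−1)^{k−1}` every summand becomes `(−1)ʲ P(μⱼ) / Aⱼ` with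
`Aⱼ > 0` — all of one weak sign, summing to `0`, hence all zero: `P(μⱼ) = 0` for every `j`.  A polynomial of degree `< k`
with `k` distinct roots vanishes (`Polynomial.eq_zero_of_degree_lt_of_eval_index_eq_zero`).

Mathlib only; THEOREMS ONLY (no definitions); no named facts; no `sorry`; default heartbeats.  Nothing about the crux 23124
(which needs Steps 1, 2, 4 in full), the route's rung or the Yang–Mills mass gap is proved here.  Free-hands seat
`ym-line-frs-p2` g10 (announced on the owner's bus 2026-08-28T19:42Z), `--supports stmt-QuantumFields-23124`.
-/

set_option autoImplicit false

namespace Summit.QuantumFields.YangMills.Theorems.RationalShortRootRigidity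

open Finset Polynomial
open scoped BigOperators Polynomial

/-! ## Sign of the node products `∏_{i ≠ j} (μⱼ − μᵢ)` -/

/-- For strictly increasing nodes, `∏_{i ≠ j} (μⱼ − μᵢ) = (−1)^{k−1−j} · ∏_{i ≠ j} |μⱼ − μᵢ|`. [folklore] -/
theorem prod_erase_eq_sign_mul {k : ℕ} (μ : Fin k → ℝ) (hμ : StrictMono μ) (j : Fin k) :
    ∏ i ∈ univ.erase j, (μ j - μ i) =
      (-1 : ℝ) ^ (k - 1 - (j : ℕ)) * ∏ i ∈ univ.erase j, |μ j - μ i| := by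
  classical
  -- each factor is `sign · |factor|` with sign `−1` exactly when `j < i`
  have hfac : ∀ i ∈ univ.erase j,
      μ j - μ i = (if j < i then (-1 : ℝ) else 1) * |μ j - μ i| := by
    intro i hi
    have hij : i ≠ j := (mem_erase.1 hi).1
    by_cases h : j < i
    · rw [if_pos h, abs_of_neg (sub_neg.2 (hμ h))]; ring
    · rw [if_neg h]
      have h' : i < j := lt_of_le_of_ne (not_lt.1 h) hij
      rw [abs_of_pos (sub_pos.2 (hμ h')), one_mul]
  rw [prod_congr rfl hfac, prod_mul_distrib, prod_ite, prod_const, prod_const_one, mul_one]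
  congr 2
  -- `#{i ≠ j : j < i} = k − 1 − j`
  have hset : (univ.erase j).filter (fun i => j < i) = Ioi j := by
    ext i
    simp only [mem_filter, mem_erase, mem_univ, and_true, mem_Ioi]
    exact ⟨fun h => h.2, fun h => ⟨ne_of_gt h, h⟩⟩
  rw [hset, Fin.card_Ioi]

/-- The node products are non-zero and `∏_{i ≠ j} |μⱼ − μᵢ| > 0`. [folklore] -/
theorem prod_erase_abs_pos {k : ℕ} (μ : Fin k → ℝ) (hμ : StrictMono μ) (j : Fin k) :
    0 < ∏ i ∈ univ.erase j, |μ j - μ i| := by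
  refine prod_pos fun i hi => abs_pos.2 (sub_ne_zero.2 fun h => ?_)
  exact (mem_erase.1 hi).1 (hμ.injective h).symm

/-! ## The alternation lemma -/

/-- **Lagrange alternation lemma** (m4; Step (4d) of the paper proof of 23124): a real polynomial of degree `≤ k − 2`
(`P.coeff n = 0` whenever `k ≤ n + 1`) whose values weakly alternate in sign over `k` strictly increasing nodes is `0`.
The statement is the body of `Helpers.LagrangeAlternation` (HOME l15/Helpers23124.lean) verbatim. [folklore] -/
theorem lagrangeAlternation :
    ∀ (k : ℕ) (P : ℝ[X]) (μ : Fin k → ℝ), StrictMono μ →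
      (∀ n : ℕ, k ≤ n + 1 → P.coeff n = 0) →
      ((∀ j : Fin k, 0 ≤ (-1 : ℝ) ^ (j : ℕ) * P.eval (μ j)) ∨
        (∀ j : Fin k, (-1 : ℝ) ^ (j : ℕ) * P.eval (μ j) ≤ 0)) →
      P = 0 := by
  classical
  intro k P μ hμ hcoeff halt
  have hinj : Set.InjOn μ (univ : Finset (Fin k)) := hμ.injective.injOn
  -- `deg P < k`
  have hdeg : P.degree < #(univ : Finset (Fin k)) := by
    rw [card_univ, Fintype.card_fin]
    exact (degree_lt_iff_coeff_zero P k).2 fun m hm => hcoeff m (by omega)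
  -- Lagrange: the top coefficient is the weighted node sum, and it vanishes
  have hsum : ∑ j ∈ (univ : Finset (Fin k)), P.eval (μ j) / ∏ i ∈ univ.erase j, (μ j - μ i) = 0 := by
    rw [← Lagrange.coeff_eq_sum hinj hdeg, card_univ, Fintype.card_fin]
    exact hcoeff (k - 1) (by omega)
  -- rewrite every summand as `(−1)^{k−1} · ((−1)^j P(μⱼ)) / Aⱼ`, `Aⱼ = ∏_{i ≠ j} |μⱼ − μᵢ| > 0`
  have hApos : ∀ j : Fin k, 0 < ∏ i ∈ univ.erase j, |μ j - μ i| := fun j => prod_erase_abs_pos μ hμ j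
  have hterm : ∀ j : Fin k, P.eval (μ j) / ∏ i ∈ univ.erase j, (μ j - μ i) =
      (-1 : ℝ) ^ (k - 1) * (((-1 : ℝ) ^ (j : ℕ) * P.eval (μ j)) / ∏ i ∈ univ.erase j, |μ j - μ i|) := by
    intro j
    have hj : (j : ℕ) < k := j.isLt
    have hAj : (∏ i ∈ univ.erase j, |μ j - μ i|) ≠ 0 := (hApos j).ne'
    have hsplit : (-1 : ℝ) ^ (k - 1) = (-1) ^ (k - 1 - (j : ℕ)) * (-1) ^ (j : ℕ) := by
      rw [← pow_add]; congr 1; omega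
    rw [prod_erase_eq_sign_mul μ hμ j, hsplit]
    rcases neg_one_pow_eq_or ℝ (k - 1 - (j : ℕ)) with h1 | h1 <;>
      rcases neg_one_pow_eq_or ℝ (j : ℕ) with h2 | h2 <;>
      · rw [h1, h2]; field_simp
  have hsum' : ∑ j ∈ (univ : Finset (Fin k)),
      ((-1 : ℝ) ^ (j : ℕ) * P.eval (μ j)) / ∏ i ∈ univ.erase j, |μ j - μ i| = 0 := by
    have h := hsum
    simp_rw [hterm, ← mul_sum] at h
    rcases mul_eq_zero.1 h with h | h
    · exact absurd h (pow_ne_zero _ (by norm_num))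
    · exact h
  -- all summands have one weak sign, so each vanishes
  have hzero : ∀ j : Fin k, P.eval (μ j) = 0 := by
    have key : ∀ j ∈ (univ : Finset (Fin k)),
        ((-1 : ℝ) ^ (j : ℕ) * P.eval (μ j)) / ∏ i ∈ univ.erase j, |μ j - μ i| = 0 := by
      rcases halt with hpos | hneg
      · exact (sum_eq_zero_iff_of_nonneg fun j _ => div_nonneg (hpos j) (hApos j).le).1 hsum'
      · have hsum'' : ∑ j ∈ (univ : Finset (Fin k)),
            -(((-1 : ℝ) ^ (j : ℕ) * P.eval (μ j)) / ∏ i ∈ univ.erase j, |μ j - μ i|) = 0 := by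
          rw [sum_neg_distrib, hsum', neg_zero]
        have := (sum_eq_zero_iff_of_nonneg fun j _ =>
          neg_nonneg.2 (div_nonpos_of_nonpos_of_nonneg (hneg j) (hApos j).le)).1 hsum''
        intro j hj
        exact neg_eq_zero.1 (this j hj)
    intro j
    have h := key j (mem_univ j)
    rw [div_eq_zero_iff] at h
    rcases h with h | h
    · rcases mul_eq_zero.1 h with h | h
      · exact absurd h (pow_ne_zero _ (by norm_num))
      · exact h
    · exact absurd h (hApos j).ne'
  exact Polynomial.eq_zero_of_degree_lt_of_eval_index_eq_zero _ hinj hdeg fun j _ => hzero j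

end Summit.QuantumFields.YangMills.Theorems.RationalShortRootRigidity
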